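import Summits.ABC.IUTFork.Cor312Ind2BallsRamified
import Summits.ABC.IUTFork.Thm311RealIsmDHUnramified
import Literature.IUT.LogVolume.LatticeAutStableSubgroups
import Literature.IUT.LogVolume.AdaptedBasis
import HarnessLib

/-!
# [IUTchIII] Cor. 3.12, TEAM R `indFixes` thread: WHICH multiples `c·I_v` of the log-shell the Dupuy–Hilado
# (Ind2) group `Real.ismDH` fixes — the criterion at every finite place, and a mover at every ramified place

PROOF-ONLY file (0 definitions, 0 named facts) of the abc-iut cell (WAVE-5 prover seat abc-iut-w5-d039, gen 6;
successor item «movers at `e ≥ 3` / wild places» of abc-iut-w5-d216's `Thm311RealIsmDHMover` series for TEAM R,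
lead abc-iut-c312-14 = R1; SHELL-MULTIPLE companion of abc-iut-w5-d180's BALL criterion
`Thm311RealIsmDHMoverCriterion` p432150, both over the campaign-S lattice classification
`PadicModule.forall_image_eq_iff_exists_zpow`, p431697).  TAKES NO SIDE on [IUTchIII] Cor. 3.12.

R1's `Cor312IdentifiedIndFixes` (p418763) asked for «`∃ φ ∈ Real.ismDH logv (.inr v), φ '' (c • I_v) ≠ c • I_v`
for a NON-rational scaling `c` at a ramified `v`» — a statement about the MULTIPLES `c • I_v` OF THE LOG-SHELL
(at a wild place `I_v` is no ball).  The tree holds it at `e = 2, f = 1, p ≥ 5` (`exists_ismDH_moves_smul_shell`)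
and at the place of `ℚ(ζ₃)` over `3` (`ramified_mover_analyticLogv`).  THIS FILE, at EVERY finite place `v ∣ p` of
EVERY number field, for the analytic logarithm (`LogvAnalyticAt`), and EVERY `c ≠ 0`:
* `forall_image_smul_logUnits_iff` — the `ℚ_p`-linear automorphisms of `K_v` fixing `log_p(𝒪_v^×)` all fix
  `c • log_p(𝒪_v^×)` iff `c • log_p(𝒪_v^×) = p^k • log_p(𝒪_v^×)` for some `k ∈ ℤ` (`log_p(𝒪_v^×)` is the
  lattice of an adapted basis; the `Aut(Λ)`-stable compact subgroups are the `p^k Λ`, Weil *BNT* II §2);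
* **`forall_ismDH_image_smul_shell_iff`** — `(∀ g ∈ Real.ismDH logv (inr v), g '' (c • I_v) = c • I_v) ↔
  ∃ k : ℤ, c • I_v = p^k • I_v` (members are `ℚ_p`-linear by continuity; `I_v = (p^*)⁻¹ • log_p(𝒪_v^×)`;
  lattice automorphisms are members, abc-iut-c312-5's construction of p429534);
* **`exists_norm_eq_zpow_of_forall_ismDH_image`** — if `c • Λ = p^k • Λ` for a bounded `Λ ∋ x₀ ≠ 0` then
  `u := p^{-k}c` and `u⁻¹` stabilise `Λ`, so `‖u‖ = 1`: stability forces `‖c‖ = p^{-k}` in the rescaled norm of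
  `K_v`, i.e. **`e(v|p) ∣ ord_v(c)`**; hence (**`exists_ismDH_image_smul_shell_ne_of_forall_norm_ne`**) every
  `c ≠ 0` with `e(v|p) ∤ ord_v(c)` — tame or wild, any residue characteristic and degree — is MOVED;
* **`exists_ismDH_moves_smul_shell_of_two_le_absRamificationIdx`** / **`…_of_two_le_ramificationIdx`** — R1's
  literal signature at EVERY RAMIFIED place: abc-iut-w5-d216's `exists_ismDH_moves_smul_shell` (p421508) with
  `p ≥ 5`, `e = 2`, `f = 1` replaced by `e ≥ 2`.

ADJUDICATION BOOKKEEPING (neutral): with R1's `ismDH_image_smul_shell` (rational `c` are fixed) this is the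
dividing line for the `indFixes` clause at the DH (Ind2) family on shell multiples; which reading of [IUTchIII]
Thm. 3.11 (i) (Ind2) is print's is for the referee lanes.  [cite: DupuyHilado2025, §4.9]
[cite: WeilBNT1967, Ch. II §2, Th. 1] [claim: Mochizuki2012, status: disputed] for every [IUTchIII] locution.
Consumed BY NAME: `RescaledCompletion` (S7), `logUnits`/`AdaptedBasis`/`LatticeAutStableSubgroups` (S),
`Real.ismDH`/`toR`/`ofR`/`LogvAnalyticAt`/`mem_shell_iff_mem_smul_logUnits` (c312-5), `analyticLogv` (c312-1).
-/

noncomputable section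

open Set Metric NumberField IsDedekindDomain
open scoped Pointwise

namespace Summit.ABC.IUTFork.Thm311.Real

open Literature.IUT.LogVolume Literature.IUT.LogThetaLattice Literature.NumberTheory.NumberFields
open Literature.NumberTheory.GaloisRepresentations.Ultrametric

namespace IsmDHStable

/-- A linear automorphism commutes with scaling of sets: `φ '' (a • T) = a • φ '' T`. [folklore] -/
theorem image_smul_set_linearEquiv {p : ℕ} [Fact p.Prime] {W : Type*} [AddCommGroup W] [Module ℚ_[p] W]
    (φ : W ≃ₗ[ℚ_[p]] W) (a : ℚ_[p]) (T : Set W) : ⇑φ '' (a • T) = a • (⇑φ '' T) := by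
  ext y
  simp only [Set.mem_image, Set.mem_smul_set]
  constructor
  · rintro ⟨_, ⟨s, hs, rfl⟩, rfl⟩
    exact ⟨φ s, ⟨s, hs, rfl⟩, (map_smul φ a s).symm⟩
  · rintro ⟨_, ⟨s, hs, rfl⟩, rfl⟩
    exact ⟨a • s, ⟨s, hs, rfl⟩, map_smul φ a s⟩

variable {K : Type*} [NormedField K]

/-- If `u • T = T` for a bounded set `T` containing a non-zero vector, then `‖u‖ ≤ 1`
(iterate: `uⁿ x₀ ∈ T`). [folklore] -/
theorem norm_le_one_of_smul_set_eq {T : Set K} {R : ℝ} (hT : ∀ x ∈ T, ‖x‖ ≤ R) {x₀ : K} (hx₀T : x₀ ∈ T)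
    (hx₀ : x₀ ≠ 0) {u : K} (hu : u • T = T) : ‖u‖ ≤ 1 := by
  by_contra h
  rw [not_le] at h
  have hmem : ∀ n : ℕ, u ^ n * x₀ ∈ T := by
    intro n
    induction n with
    | zero => simpa using hx₀T
    | succ n ih =>
      have h' : u • (u ^ n * x₀) ∈ u • T := Set.smul_mem_smul_set ih
      rw [hu, smul_eq_mul, ← mul_assoc, ← pow_succ'] at h'
      exact h'
  have hx₀pos : 0 < ‖x₀‖ := norm_pos_iff.mpr hx₀
  obtain ⟨n, hn⟩ := pow_unbounded_of_one_lt (R / ‖x₀‖) h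
  have h1 : ‖u ^ n * x₀‖ ≤ R := hT _ (hmem n)
  rw [norm_mul, norm_pow] at h1
  exact absurd (hn.trans_le ((le_div_iff₀ hx₀pos).mpr h1)) (lt_irrefl _)

/-- If `u • T = T` (`u ≠ 0`) for a bounded set `T` containing a non-zero vector, then `‖u‖ = 1`. [folklore] -/
theorem norm_eq_one_of_smul_set_eq {T : Set K} {R : ℝ} (hT : ∀ x ∈ T, ‖x‖ ≤ R) {x₀ : K} (hx₀T : x₀ ∈ T)
    (hx₀ : x₀ ≠ 0) {u : K} (hu0 : u ≠ 0) (hu : u • T = T) : ‖u‖ = 1 := by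
  refine le_antisymm (norm_le_one_of_smul_set_eq hT hx₀T hx₀ hu) ?_
  have hu' : u⁻¹ • T = T := by
    conv_lhs => rw [← hu]
    rw [smul_smul, inv_mul_cancel₀ hu0, one_smul]
  have h := norm_le_one_of_smul_set_eq hT hx₀T hx₀ hu'
  rw [norm_inv] at h
  exact (inv_le_one₀ (norm_pos_iff.mpr hu0)).mp h

end IsmDHStable

/-! ## 2. At a finite place: the stabiliser criterion for multiples of `log_p(𝒪_v^×)`, and the norm it forces -/

section Field

variable {F : Type} [Field F] [NumberField F] (p : ℕ) [hp : Fact p.Prime]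
variable (v : HeightOneSpectrum (𝓞 F)) (hv : ((p : ℕ) : 𝓞 F) ∈ v.asIdeal)

/-- **The `ℚ_p`-linear automorphisms of `K_v` fixing `log_p(𝒪_v^×)` all fix `c • log_p(𝒪_v^×)` iff
`c • log_p(𝒪_v^×) = p^k • log_p(𝒪_v^×)` for some `k ∈ ℤ`** (`c ≠ 0`): `log_p(𝒪_v^×)` is the lattice of an
adapted basis and `c • log_p(𝒪_v^×)` a compact subgroup, so campaign-S's classification of the `Aut(Λ)`-stable
compact subgroups (`PadicModule.forall_image_eq_iff_exists_zpow`, Weil *BNT* II §2) applies.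
[cite: WeilBNT1967, Ch. II §2, Th. 1] [cite: DupuyHilado2025, §4.9] -/
theorem forall_image_smul_logUnits_iff (c : RescaledCompletion F p v hv) (hc : c ≠ 0) :
    (∀ φ : RescaledCompletion F p v hv ≃ₗ[ℚ_[p]] RescaledCompletion F p v hv,
        ⇑φ '' logUnits (RescaledCompletion F p v hv) = logUnits (RescaledCompletion F p v hv) →
        ⇑φ '' (c • logUnits (RescaledCompletion F p v hv)) = c • logUnits (RescaledCompletion F p v hv)) ↔
      ∃ k : ℤ, c • logUnits (RescaledCompletion F p v hv) =
        ((p : ℚ_[p]) ^ k) • logUnits (RescaledCompletion F p v hv) := by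
  obtain ⟨n, bZ, b, cc, hn, -, hM⟩ := exists_adaptedBasis p (logUnitsAddSubgroup p (RescaledCompletion F p v hv))
    (isOpen_logUnits p _) (isCompact_logUnits p _)
  haveI : Nonempty (Fin n) := ⟨⟨0, hn⟩⟩
  -- `log_p(𝒪^×) = L_B` for the rescaled basis `B := (cc_j • b_j)_j`
  have hΛ : (logUnits (RescaledCompletion F p v hv) : Set (RescaledCompletion F p v hv)) =
      (PadicModule.basisLattice p (b.unitsSMul cc) : Set (RescaledCompletion F p v hv)) := by
    ext x
    rw [← PadicModule.boxLattice_eq_basisLattice_unitsSMul, SetLike.mem_coe, ← hM x]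
    rfl
  -- `φ` fixes `log_p(𝒪^×)` iff it is a lattice automorphism of `L_B`
  have hmem : ∀ φ : RescaledCompletion F p v hv ≃ₗ[ℚ_[p]] RescaledCompletion F p v hv,
      φ ∈ latticeAut ℚ_[p] (PadicModule.basisLattice p (b.unitsSMul cc)).toIntSubmodule ↔
        ⇑φ '' logUnits (RescaledCompletion F p v hv) = logUnits (RescaledCompletion F p v hv) := by
    intro φ
    constructor
    · intro hφ
      rw [hΛ]
      exact latticeAut.image_eq hφ
    · intro h
      refine mem_latticeAut_of_mapsTo φ (fun x hx => ?_) (fun x hx => ?_)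
      · have hx' : x ∈ logUnits (RescaledCompletion F p v hv) := by rw [hΛ]; exact hx
        have : φ x ∈ logUnits (RescaledCompletion F p v hv) := by rw [← h]; exact ⟨x, hx', rfl⟩
        rw [hΛ] at this
        exact this
      · have hx' : x ∈ ⇑φ '' logUnits (RescaledCompletion F p v hv) := by rw [h, hΛ]; exact hx
        obtain ⟨y, hy, hyx⟩ := hx'
        have : φ.symm x = y := by rw [← hyx, LinearEquiv.symm_apply_apply]
        rw [hΛ] at hy
        show φ.symm x ∈ PadicModule.basisLattice p (b.unitsSMul cc)
        rw [this]
        exact hy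
  -- the compact subgroup `c • log_p(𝒪^×)`
  let L : AddSubgroup (RescaledCompletion F p v hv) :=
    (logUnitsAddSubgroup p (RescaledCompletion F p v hv)).map (AddMonoidHom.mulLeft c)
  have hL : (L : Set (RescaledCompletion F p v hv)) = c • logUnits (RescaledCompletion F p v hv) := by
    ext y
    simp only [L, AddSubgroup.coe_map, coe_logUnitsAddSubgroup, AddMonoidHom.coe_mulLeft, Set.mem_image,
      Set.mem_smul_set, smul_eq_mul]
  have hLc : IsCompact (L : Set (RescaledCompletion F p v hv)) := by
    rw [hL]
    exact (isCompact_logUnits p (RescaledCompletion F p v hv)).smul c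
  have hL0 : ∃ x ∈ L, x ≠ 0 := by
    refine ⟨c * b.unitsSMul cc ⟨0, hn⟩, ?_, mul_ne_zero hc ((b.unitsSMul cc).ne_zero _)⟩
    rw [← SetLike.mem_coe, hL]
    refine Set.smul_mem_smul_set ?_
    rw [hΛ]
    exact PadicModule.basis_mem_basisLattice p (b.unitsSMul cc) _
  have hclass := PadicModule.forall_image_eq_iff_exists_zpow p (b.unitsSMul cc) L hLc hL0
  rw [hL, ← hΛ] at hclass
  rw [← hclass]
  constructor
  · intro h φ hφ
    exact h φ ((hmem φ).mp hφ)
  · intro h φ hφ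
    exact h φ ((hmem φ).mpr hφ)

/-- **Stability forces an integral power of `p`**: if `c • log_p(𝒪_v^×) = p^k • log_p(𝒪_v^×)` (`c ≠ 0`), then
`‖c‖ = p^{-k}` in the rescaled norm of `K_v`, i.e. `ord_v(c) = k·e(v|p)` (`u := p^{-k}c` and `u⁻¹` stabilise the
bounded set `log_p(𝒪_v^×) ∋ x₀ ≠ 0`, so `‖u‖ = 1`). [cite: WeilBNT1967, Ch. II §2, Th. 2] -/
theorem norm_eq_zpow_of_smul_logUnits_eq {c : RescaledCompletion F p v hv} (hc : c ≠ 0) {k : ℤ}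
    (h : c • logUnits (RescaledCompletion F p v hv) = ((p : ℚ_[p]) ^ k) • logUnits (RescaledCompletion F p v hv)) :
    ‖c‖ = (p : ℝ) ^ (-k) := by
  have hp0 : (p : ℚ_[p]) ≠ 0 := Nat.cast_ne_zero.mpr hp.out.ne_zero
  -- `log_p(𝒪^×)` is bounded and contains a non-zero vector
  obtain ⟨R, hR⟩ := (isCompact_logUnits p (RescaledCompletion F p v hv)).isBounded.subset_closedBall
    (0 : RescaledCompletion F p v hv)
  have hTb : ∀ x ∈ logUnits (RescaledCompletion F p v hv), ‖x‖ ≤ R := fun x hx => by simpa using hR hx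
  obtain ⟨n, bZ, b, cc, hn, -, hM⟩ := exists_adaptedBasis p (logUnitsAddSubgroup p (RescaledCompletion F p v hv))
    (isOpen_logUnits p _) (isCompact_logUnits p _)
  have hx₀T : (b.unitsSMul cc ⟨0, hn⟩ : RescaledCompletion F p v hv) ∈ logUnits (RescaledCompletion F p v hv) := by
    have h1 : (b.unitsSMul cc ⟨0, hn⟩ : RescaledCompletion F p v hv) ∈
        (PadicModule.basisLattice p (b.unitsSMul cc) : Set (RescaledCompletion F p v hv)) :=
      PadicModule.basis_mem_basisLattice p (b.unitsSMul cc) _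
    rw [← PadicModule.boxLattice_eq_basisLattice_unitsSMul, SetLike.mem_coe, ← hM] at h1
    exact h1
  have hx₀ : (b.unitsSMul cc ⟨0, hn⟩ : RescaledCompletion F p v hv) ≠ 0 := (b.unitsSMul cc).ne_zero _
  -- `u := p^{-k} • c` stabilises `log_p(𝒪^×)`
  have hu0 : ((p : ℚ_[p]) ^ (-k)) • c ≠ 0 := smul_ne_zero (zpow_ne_zero _ hp0) hc
  have huT : (((p : ℚ_[p]) ^ (-k)) • c) • logUnits (RescaledCompletion F p v hv) =
      logUnits (RescaledCompletion F p v hv) := by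
    rw [smul_assoc, h, smul_smul, zpow_neg, inv_mul_cancel₀ (zpow_ne_zero _ hp0), one_smul]
  have hnu : ‖((p : ℚ_[p]) ^ (-k)) • c‖ = 1 := IsmDHStable.norm_eq_one_of_smul_set_eq hTb hx₀T hx₀ hu0 huT
  have hcu : c = ((p : ℚ_[p]) ^ k) • (((p : ℚ_[p]) ^ (-k)) • c) := by
    rw [smul_smul, zpow_neg, mul_inv_cancel₀ (zpow_ne_zero _ hp0), one_smul]
  rw [hcu, norm_smul, hnu, mul_one, norm_zpow, Padic.norm_p, inv_zpow']

variable {p}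

/-- Bridge between the two typings of `K_v`: the multiple `(p : K_v)^k • T` of a set, formed in c312-5's carrier
`Real.Carrier (inr v)`, is the `ℚ_p`-scalar multiple `(p^k : ℚ_p) • T` in abc-iut-S7's rescaled completion (same
underlying set; `algebraMap ℚ_p K_v (p^k) = p^k`). [folklore] -/
theorem zpow_prime_smul_set_carrier_eq (k : ℤ) {T' : Set (Carrier (.inr v : Place F))}
    {T : Set (RescaledCompletion F p v hv)} (hT : T' = T) :
    ((p : Carrier (.inr v : Place F)) ^ k) • T' =
      (((p : ℚ_[p]) ^ k) • T : Set (RescaledCompletion F p v hv)) := by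
  have hscal : ∀ z : RescaledCompletion F p v hv,
      (((p : ℚ_[p]) ^ k) • z : RescaledCompletion F p v hv) =
        toR p v hv (((p : Carrier (.inr v : Place F)) ^ k) • ofR p v hv z) := fun z => by
    rw [Algebra.smul_def, map_zpow₀, map_natCast]
    rfl
  rw [hT]
  ext y
  constructor
  · intro hy
    obtain ⟨z, hz, rfl⟩ := Set.mem_smul_set.mp hy
    show toR p v hv (((p : Carrier (.inr v : Place F)) ^ k) • ofR p v hv z) ∈ ((p : ℚ_[p]) ^ k) • T
    rw [← hscal z]
    exact Set.smul_mem_smul_set hz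
  · intro hy
    have hy' : toR p v hv y ∈ ((p : ℚ_[p]) ^ k) • T := hy
    obtain ⟨z, hz, hzy⟩ := Set.mem_smul_set.mp hy'
    exact Set.mem_smul_set.mpr ⟨ofR p v hv z, hz, (hscal z).symm.trans hzy⟩

include hv in
/-- **THE STABILISER CRITERION FOR SHELL MULTIPLES AT THE TYPED (Ind2) GROUP.** At a place `v ∣ p` where `logv` is
the analytic logarithm, for every `c ≠ 0` in `K_v`: ALL of Dupuy–Hilado's `Real.ismDH logv (inr v)` (bicontinuous
`ℚ`-linear automorphisms of `K_v` fixing `I_v`) fix `c • I_v` **iff `c • I_v = p^k • I_v` for some `k ∈ ℤ`**.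
(`⇒`: lattice automorphisms are members and `I_v = (p^*)⁻¹ • log_p(𝒪_v^×)`, so §2 applies; `⇐`: members are
`ℚ_p`-linear by continuity.) [cite: DupuyHilado2025, §4.9] [cite: WeilBNT1967, Ch. II §2, Th. 1] -/
theorem forall_ismDH_image_smul_shell_iff {logv : PadicLogs F} (hlog : LogvAnalyticAt p logv)
    (c : Carrier (.inr v : Place F)) (hc : c ≠ 0) :
    (∀ g ∈ ismDH logv (.inr v : Place F),
        ⇑g '' (c • shell logv (.inr v : Place F)) = c • shell logv (.inr v : Place F)) ↔
      ∃ k : ℤ, c • shell logv (.inr v : Place F) =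
        ((p : Carrier (.inr v : Place F)) ^ k) • shell logv (.inr v : Place F) := by
  set K := RescaledCompletion F p v hv
  haveI := finiteDimensional_rescaledCompletion p v hv
  have hps0 : ((pStar p : ℕ) : ℚ_[p]) ≠ 0 := Nat.cast_ne_zero.mpr (pStar_ne_zero hp.out.ne_zero)
  set a : ℚ_[p] := ((pStar p : ℕ) : ℚ_[p])⁻¹ with ha
  have ha0 : a ≠ 0 := inv_ne_zero hps0
  -- the shell, read in the rescaled field (same underlying set), is `a • log_p(𝒪^×)`; the two scalings read in `K`
  have hshell : (shell logv (.inr v) : Set (Carrier (.inr v : Place F))) = (a • logUnits K : Set K) :=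
    Set.ext fun x => mem_shell_iff_mem_smul_logUnits v hv hlog x
  have hcs : (c • shell logv (.inr v) : Set (Carrier (.inr v : Place F))) =
      ((toR p v hv c) • (a • logUnits K) : Set K) := by
    rw [hshell]; rfl
  have hpk : ∀ k : ℤ, (((p : Carrier (.inr v : Place F)) ^ k) • shell logv (.inr v) :
      Set (Carrier (.inr v : Place F))) = (((p : ℚ_[p]) ^ k) • (a • logUnits K) : Set K) :=
    fun k => zpow_prime_smul_set_carrier_eq v hv k hshell
  -- `c • (a • Λ₀) = p^k • (a • Λ₀)` iff `c • Λ₀ = p^k • Λ₀`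
  have hiff : ∀ k : ℤ, (toR p v hv c) • (a • logUnits K) = ((p : ℚ_[p]) ^ k) • (a • logUnits K) ↔
      (toR p v hv c) • logUnits K = ((p : ℚ_[p]) ^ k) • logUnits K := by
    intro k
    rw [smul_comm (toR p v hv c) a (logUnits K), smul_comm ((p : ℚ_[p]) ^ k) a (logUnits K)]
    constructor
    · intro h
      have := congrArg (fun T : Set K => a⁻¹ • T) h
      simpa only [smul_smul, inv_mul_cancel₀ ha0, one_smul, inv_mul_cancel_left₀ ha0] using this
    · intro h
      rw [h]
  have hcR : toR p v hv c ≠ 0 := hc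
  constructor
  · intro hfix
    -- transfer to the `ℚ_p`-linear automorphisms fixing `log_p(𝒪^×)`
    suffices hK : ∃ k : ℤ, (toR p v hv c) • logUnits K = ((p : ℚ_[p]) ^ k) • logUnits K by
      obtain ⟨k, hk⟩ := hK
      exact ⟨k, by rw [hcs, hpk k]; exact (hiff k).mpr hk⟩
    refine (forall_image_smul_logUnits_iff p v hv (toR p v hv c) hcR).mp fun φ hφ => ?_
    -- `φ` read on the carrier as a `ℚ`-linear automorphism is a member of `ismDH` (c312-5's construction)
    let g₀ : Carrier (.inr v : Place F) →+ Carrier (.inr v : Place F) := φ.toAddEquiv.toAddMonoidHom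
    let g : Carrier (.inr v : Place F) ≃ₗ[ℚ] Carrier (.inr v : Place F) :=
      { g₀.toRatLinearMap with
        invFun := φ.symm
        left_inv := φ.left_inv
        right_inv := φ.right_inv }
    have hφc : Continuous φ := φ.toLinearMap.continuous_of_finiteDimensional
    have hφc' : Continuous φ.symm := φ.symm.toLinearMap.continuous_of_finiteDimensional
    have hgshell : ⇑g '' shell logv (.inr v) = shell logv (.inr v) := by
      rw [hshell]
      show ⇑φ '' (a • logUnits K) = a • logUnits K
      rw [IsmDHStable.image_smul_set_linearEquiv, hφ]
    have h := hfix g ⟨hφc, hφc', hgshell⟩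
    rw [hcs] at h
    have h' : ⇑φ '' ((toR p v hv c) • (a • logUnits K)) = (toR p v hv c) • (a • logUnits K) := h
    rw [smul_comm (toR p v hv c) a (logUnits K), IsmDHStable.image_smul_set_linearEquiv] at h'
    have := congrArg (fun T : Set K => a⁻¹ • T) h'
    simpa only [smul_smul, inv_mul_cancel₀ ha0, one_smul] using this
  · rintro ⟨k, hk⟩ g ⟨hgc, -, hgshell⟩
    rw [hcs, hpk k] at hk
    -- `g` is `ℚ_p`-homogeneous by continuity
    let f : K →+ K := g.toAddEquiv.toAddMonoidHom
    have hfc : Continuous f := hgc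
    have hfshell : f '' (a • logUnits K) = a • logUnits K := by
      have h1 := hgshell
      rw [hshell] at h1
      exact h1
    show f '' (c • shell logv (.inr v)) = c • shell logv (.inr v)
    rw [hcs]
    show f '' ((toR p v hv c) • (a • logUnits K)) = (toR p v hv c) • (a • logUnits K)
    rw [hk, IsmDHUnram.image_smul_set f hfc, hfshell]

/-- **Stability forces `ord_v(c) ∈ e(v|p)·ℤ`.** If all of `Real.ismDH logv (inr v)` fixes `c • I_v` (`c ≠ 0`,
`logv` analytic at `v ∣ p`), then the rescaled norm of `c` is an INTEGRAL power of `p` (`‖ϖ_v‖ = p^{-1/e}`: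
`e(v|p) ∣ ord_v(c)`). [cite: DupuyHilado2025, §4.9] [cite: WeilBNT1967, Ch. II §2, Th. 2] -/
theorem exists_norm_eq_zpow_of_forall_ismDH_image {logv : PadicLogs F} (hlog : LogvAnalyticAt p logv)
    {c : Carrier (.inr v : Place F)} (hc : c ≠ 0)
    (hfix : ∀ g ∈ ismDH logv (.inr v : Place F),
      ⇑g '' (c • shell logv (.inr v : Place F)) = c • shell logv (.inr v : Place F)) :
    ∃ k : ℤ, ‖toR p v hv c‖ = (p : ℝ) ^ k := by
  set K := RescaledCompletion F p v hv
  have hps0 : ((pStar p : ℕ) : ℚ_[p]) ≠ 0 := Nat.cast_ne_zero.mpr (pStar_ne_zero hp.out.ne_zero)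
  obtain ⟨k, hk⟩ := (forall_ismDH_image_smul_shell_iff v hv hlog c hc).mp hfix
  have hshell : (shell logv (.inr v) : Set (Carrier (.inr v : Place F))) =
      ((((pStar p : ℕ) : ℚ_[p])⁻¹ • logUnits K : Set K)) :=
    Set.ext fun x => mem_shell_iff_mem_smul_logUnits v hv hlog x
  have h1 : (c • shell logv (.inr v) : Set (Carrier (.inr v : Place F))) =
      ((toR p v hv c) • ((((pStar p : ℕ) : ℚ_[p])⁻¹ • logUnits K)) : Set K) := by
    rw [hshell]; rfl
  rw [h1, zpow_prime_smul_set_carrier_eq v hv k hshell, smul_comm (toR p v hv c),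
    smul_comm ((p : ℚ_[p]) ^ k)] at hk
  have hk' : (toR p v hv c) • logUnits K = ((p : ℚ_[p]) ^ k) • logUnits K := by
    have := congrArg (fun T : Set K => (((pStar p : ℕ) : ℚ_[p])⁻¹)⁻¹ • T) hk
    simpa only [smul_smul, inv_mul_cancel₀ (inv_ne_zero hps0), one_smul,
      inv_mul_cancel_left₀ (inv_ne_zero hps0)] using this
  exact ⟨-k, norm_eq_zpow_of_smul_logUnits_eq p v hv hc hk'⟩

/-- **MOVERS, general form.** At a place `v ∣ p` where `logv` is the analytic logarithm, every `c ≠ 0` of `K_v`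
whose rescaled norm is NOT an integral power of `p` — i.e. `e(v|p) ∤ ord_v(c)`, e.g. a uniformizer at a ramified
place, tame or wild, any residue characteristic — carries a shell multiple `c • I_v` that SOME element of
`Real.ismDH logv (inr v)` moves. [cite: DupuyHilado2025, §4.9] [cite: WeilBNT1967, Ch. II §2, Th. 2] -/
theorem exists_ismDH_image_smul_shell_ne_of_forall_norm_ne {logv : PadicLogs F} (hlog : LogvAnalyticAt p logv)
    {c : Carrier (.inr v : Place F)} (hc : c ≠ 0) (hn : ∀ k : ℤ, ‖toR p v hv c‖ ≠ (p : ℝ) ^ k) :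
    ∃ g ∈ ismDH logv (.inr v : Place F),
      ⇑g '' (c • shell logv (.inr v : Place F)) ≠ c • shell logv (.inr v : Place F) := by
  by_contra h
  push Not at h
  obtain ⟨k, hk⟩ := exists_norm_eq_zpow_of_forall_ismDH_image v hv hlog hc h
  exact hn k hk

/-- **A RAMIFIED MOVER AT EVERY RAMIFIED PLACE** (R1's open signature, all `e_v ≥ 2`): at a place `v ∣ p` with
absolute ramification index `e_v ≥ 2` and `logv` analytic, there are a non-unit `c ≠ 0` of `K_v` (a uniformizer:
`p⁻¹ < ‖c‖' < 1`, campaign-S `exists_norm_mem_Ioo_of_two_le_absRamificationIdx`) and `g ∈ Real.ismDH logv (inr v)`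
with `g '' (c • I_v) ≠ c • I_v` — no hypothesis on `p`, tameness or residue degree. [cite: DupuyHilado2025, §4.9] -/
theorem exists_ismDH_moves_smul_shell_of_two_le_absRamificationIdx {logv : PadicLogs F}
    (hlog : LogvAnalyticAt p logv) (he : 2 ≤ absRamificationIdx p (RescaledCompletion F p v hv)) :
    ∃ c : Carrier (.inr v : Place F), c ≠ 0 ∧ ‖c‖ < 1 ∧
      ∃ g ∈ ismDH logv (.inr v : Place F),
        ⇑g '' (c • shell logv (.inr v : Place F)) ≠ c • shell logv (.inr v : Place F) := by
  have hp1 : (1 : ℝ) < p := by exact_mod_cast hp.out.one_lt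
  obtain ⟨x, hx1, hx2⟩ := PadicModule.exists_norm_mem_Ioo_of_two_le_absRamificationIdx p he
  have hx0 : ofR p v hv x ≠ 0 := by
    intro h0
    have h0' : x = 0 := h0
    rw [h0', norm_zero] at hx1
    exact absurd hx1 (not_lt.mpr (by positivity))
  have hn : ∀ k : ℤ, ‖toR p v hv (ofR p v hv x)‖ ≠ (p : ℝ) ^ k := by
    intro k hk
    have hk' : ‖x‖ = (p : ℝ) ^ k := hk
    rw [hk'] at hx1 hx2
    have h1 : (-1 : ℤ) < k := (zpow_lt_zpow_iff_right₀ hp1).mp (by rwa [zpow_neg_one])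
    have h2 : k < 0 := (zpow_lt_zpow_iff_right₀ hp1).mp (by rwa [zpow_zero])
    omega
  refine ⟨ofR p v hv x, hx0, ?_, exists_ismDH_image_smul_shell_ne_of_forall_norm_ne v hv hlog hx0 hn⟩
  -- `|c|_v = ‖c‖'^{n_v} < 1`
  have h : ‖ofR p v hv x‖ = ‖x‖ ^ localDeg F v := RescaledCompletion.norm_eq_norm_of_pow F p v hv _
  rw [h]
  exact pow_lt_one₀ (norm_nonneg _) hx2 (localDeg_pos F v).ne'

/-- **At the analytic family of record** (abc-iut-c312-1 `Real.analyticLogv`): at every finite place `v` of every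
number field with ramification index `e(v|p_v) ≥ 2` there are a non-unit `c ≠ 0` of `K_v` and
`φ ∈ Real.ismDH (analyticLogv F) (inr v)` with `φ '' (c • I_v) ≠ c • I_v` — abc-iut-w5-d216's
`exists_ismDH_moves_smul_shell` (p421508: `p ≥ 5`, `e = 2`, `f = 1`) with its three hypotheses replaced by `e ≥ 2`.
[cite: DupuyHilado2025, §4.9] [cite: NeukirchANT1999, Ch. II Prop. (6.8)] -/
theorem exists_ismDH_moves_smul_shell_of_two_le_ramificationIdx (hres : residueChar F v = p)
    (he : 2 ≤ v.asIdeal.ramificationIdx ℤ) :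
    ∃ c : Carrier (.inr v : Place F), c ≠ 0 ∧ ‖c‖ < 1 ∧
      ∃ φ ∈ ismDH (analyticLogv F) (.inr v : Place F),
        ⇑φ '' (c • shell (analyticLogv F) (.inr v : Place F)) ≠
          c • shell (analyticLogv F) (.inr v : Place F) := by
  have hv' : ((p : ℕ) : 𝓞 F) ∈ v.asIdeal := hres ▸ natCast_residueChar_mem F v
  have he' : 2 ≤ absRamificationIdx p (RescaledCompletion F p v hv') := by
    rwa [absRamificationIdx_rescaledCompletion F p v hv']
  exact exists_ismDH_moves_smul_shell_of_two_le_absRamificationIdx v hv' (logvAnalyticAt_analyticLogv p) he'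

end Field

end Summit.ABC.IUTFork.Thm311.Real

end
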